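import Summits.HodgeConjecture.HodgeConjecture.Theorems.WeilTypeLadderTensorLocalAnchorAll
import Literature.AlgebraicGeometry.HodgeTheory.WeilClassesTensorPointAlgebraic
import HarnessLib

/-!
# WeilTypeLadder · TENSOR POINTS ARE ALGEBRAIC POINTS: door T's local input is a variational-Hodge GERM at the squares

b2b cell `hweil` (packet `run/shared/lean/b2b/hodge-weil/`, LADDER `## CARVER v5` C33, DIVERGENCE D15). Carver,
generation 5. Nothing here is a new case of the Hodge conjecture and no named fact is introduced: this file makes
the ONE un-printed input of "door T" (`Theorems/WeilTypeLadderTensorLocalAnchorAll.lean`: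
R∞ / stmt-2524 / R1′ ⟸ `deligne1982_weilFamily_hodgeWeilSection_all` ∧ `HasLocallyAlgebraicTensorAnchors k d`)
LITERALLY a germ statement of variational-Hodge type, by proving that the class at the tensor point is already
algebraic.

1.–2. (Literature, `WeilClassesTensorPointAlgebraic`, this seat) `weilClassesOf_le_algebraicClasses_of_isogenyPair`
   (full-plane isogeny transfer, van Geemen 3.7) and `weilClassesOf_le_algebraicClasses_of_tensorPoint` /
   `mem_algebraicClasses_of_tensorPoint`: at every TENSOR POINT `(Y, Ψ)` of `HasLocallyAlgebraicTensorAnchors k d`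
   (`Y` `K`-isogenous to the split square `(A₁ × A₁, Ψ₀)`, `Ψ₀ = prodLift (snd ≫ (-d)) fst` = Deligne's `A₁ ⊗ K`)
   the WHOLE Weil plane is algebraic — UNCONDITIONAL, fact-free, every `k ≥ 1`, `d ≥ 1` (Deligne LNM 900
   Lemma 4.5 / Remark 4.10 in the kernel: `weilClassesOf_splitSquare_le_algebraicClasses`, p178590).
3. `HasWeilSectionGermAtTensorPoints k d` (SQGERM) — the binders of `HasLocallyAlgebraicTensorAnchors k d` VERBATIM
   plus ONE hypothesis, "`x` is algebraic on `Y`"; `hasLocallyAlgebraicTensorAnchors_iff_germ` — **TLOCAL(k,d) ⟺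
   SQGERM(k,d)** (`k, d ≥ 1`): door T's residual input is exactly *a flat global `(k,k)`-class on an abelian-fibred
   `ℤ[√-d]`-family, ALGEBRAIC at the square fibre `s₀`, is (up to `q·Hᵏ`) algebraic on a neighbourhood of `s₀`*.
4. `AbelianSchemeVHCGerm k` (AVHCG) — Grothendieck's variational Hodge conjecture in GERM form for degree-`2k`
   classes on abelian-fibred smooth projective families of relative dimension `2k` (no `K`, no `d`, no discriminant;
   fibre clause verbatim the one of `deligne1982_weilFamily_hodgeWeilSection_all`); `germ_of_abelianSchemeVHCGerm` —
   AVHCG(k) ⟹ SQGERM(k,d) for every `d`; `abelianSchemeVHCGerm_of_hodgeConjecture` — ON-PATH (HC ⟹ AVHCG).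
5. BY NAME: `weilClassesImaginaryQuadratic_of_deligneAll_of_abelianSchemeVHCGerm` — **R∞ ⟸ Deligne-all ∧
   ∀ k ≥ 2, AVHCG(k)**; `weilSixfolds_of_deligneAll_of_abelianSchemeVHCGerm` — **stmt-HodgeConjecture-2524 (ALL
   `√-d`-Weil sixfolds, every `d`, every discriminant) ⟸ Deligne-all ∧ AVHCG(3)**;
   `nonsplitSixfolds_of_deligneAll_of_abelianSchemeVHCGerm` — R1′ likewise; and the SQGERM forms.

HONEST FRAMING. AVHCG is OPEN mathematics (it is implied by the Hodge conjecture and is known in print exactly for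
classes carried by semiregular objects: lci subschemes [Bloch 1972], coherent sheaves [Buchweitz–Flenner 2003],
perfect complexes / restricted versions [Perry; Markman 2025, §8.3 and Lemma 11.3]); it is typed here as a
`Prop`-valued `def` consumed ONLY as a hypothesis, with its on-path lemma. The reduction "algebraic cycles satisfy
principle B ⟹ the Weil classes are algebraic" is Deligne's / André's pattern (LNM 900 §4 proof of Thm. 4.8;
André 1996 proves the MOTIVATED analogue of AVHCG, Thm. 0.5, and deduces Thm. 0.6.2) with 'absolute Hodge' /
'motivated' replaced by 'algebraic' — folklore; what is new is only that the tree holds it as kernel theorems modulo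
one refereed-source named fact. Rungs of the ladder proved unconditionally above the floor: still 0.

## References
* [Deligne1982HodgeCycles] P. Deligne, Hodge cycles on abelian varieties, LNM 900 (1982), §4: Lemma 4.5,
  Remark 4.10, proof of Thm. 4.8 (a)–(c).
* [vanGeemen1994HodgeAV] B. van Geemen, An introduction to the Hodge conjecture for abelian varieties, LNM 1594
  (1994), 3.6–3.7, 5.4–5.11.
* [Andre1996Motifs] Y. André, Pour une théorie inconditionnelle des motifs, Publ. Math. IHÉS 83 (1996), Thm. 0.5,
  Thm. 0.6.2, Lemme 6.3.3.
* [Grothendieck1966deRham] A. Grothendieck, On the de Rham cohomology of algebraic varieties, Publ. Math. IHÉS 29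
  (1966), footnote 13 (variational Hodge conjecture).
* [Bloch1972Semiregularity] S. Bloch, Semi-regularity and de Rham cohomology, Invent. Math. 17 (1972), Thm. 7.1.
* [BuchweitzFlenner2003] R.-O. Buchweitz, H. Flenner, A semiregularity map for modules and applications to
  deformations, Compositio Math. 137 (2003), Thm. 5.1.
* [Markman2025SecantWeil] E. Markman, Secant sheaves and Weil classes on abelian varieties (2025, unrefereed
  preprint), §1.5, §8.3, Lemma 11.3.
* [CharlesSchnell2014Notes] F. Charles, C. Schnell, Notes on absolute Hodge classes (2014), Prop. 11.3.11 (proof).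
-/

-- every declaration of this problem lives in `Summit.HodgeConjecture.HodgeConjecture.…` (summit = sub-problem)
set_option linter.dupNamespace false

noncomputable section

open CategoryTheory AlgebraicGeometry Limits MonoidalCategory CartesianMonoidalCategory

namespace Summit.HodgeConjecture.HodgeConjecture.WeilTypeLadder

open Literature.AlgebraicGeometry Literature.AlgebraicGeometry.Motives
open Literature.AlgebraicGeometry.HodgeTheory
open Literature.AlgebraicTopology.SingularHomology
open Summit.HodgeConjecture.HodgeConjecture.Theorems.HeckePrymWeilLine (owf_isoTransport)

/-! ## 1. SQGERM: the local tensor clause with the class KNOWN algebraic at `s₀` -/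

/-- **Weil-section germ at tensor points** (SQGERM(k,p)): the binders of `HasLocallyAlgebraicTensorAnchors k p`
VERBATIM, plus the single hypothesis `x ∈ algebraicClasses Y.X k` (which `mem_algebraicClasses_of_tensorPoint`
discharges). Read: *for every abelian-fibred `ℤ[√-p]`-family with quasi-projective total space over a smooth
irreducible quasi-projective base, every global class `W` with rational `(k,k)` fibre restrictions, and every
point `s₀` whose fibre is (a chart of) a tensor point `Y` at which `W|_{s₀}` is a rational, ALGEBRAIC Weil class,
there are an open `U ∋ s₀`, a global `(1,1)`-rational `H` and `q ∈ ℚ` with `(q·Hᵏ + W)|_s` algebraic for all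
`s ∈ U`* — a variational-Hodge GERM statement. Consumed only as a hypothesis.
[cite: Deligne1982HodgeCycles, proof of Thm. 4.8 (c)] [cite: Grothendieck1966deRham, footnote 13]
[cite: Markman2025SecantWeil, §1.5] [status: open] -/
@[conjecture] def HasWeilSectionGermAtTensorPoints (k p : ℕ) : Prop :=
  ∀ (Y : AbelianVariety ℂ) (Ψ : Y ⟶ Y), Y.dim = 2 * k → Ψ ≫ Ψ = -((p : ℤ) • 𝟙 Y) →
    (∃ (A₁ : AbelianVariety ℂ) (f₁ : Y ⟶ A₁.prod A₁) (g₁ : A₁.prod A₁ ⟶ Y) (m : ℕ),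
      A₁.dim = k ∧ 0 < m ∧ f₁ ≫ g₁ = m • 𝟙 Y ∧ Flat f₁.hom.hom.hom.left ∧
      g₁ ≫ Ψ = AbelianVariety.prodLift
        (AbelianVariety.snd A₁ A₁ ≫ (-((p : ℤ) • 𝟙 A₁))) (AbelianVariety.fst A₁ A₁) ≫ g₁) →
    ∀ (x : complexBetti Y.X (2 * k)), x ∈ weilClassesOf Y Ψ k p → IsRationalClass x →
    x ∈ algebraicClasses Y.X k →
    ∀ ⦃𝒳 S : SchemeOver ℂ⦄ (f : 𝒳 ⟶ S), IsSmoothProjectiveFamily f (2 * k) →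
      IsQuasiProjectiveOver 𝒳 → IsQuasiProjectiveOver S → IrreducibleSpace S.left → Smooth S.hom →
      (∀ s : ComplexPoints S, ∃ (A' : AbelianVariety ℂ) (φ' : A' ⟶ A'),
          A'.dim = 2 * k ∧ φ' ≫ φ' = -((p : ℤ) • 𝟙 A') ∧ Nonempty (A'.X ≅ fiberOver f s)) →
      ∀ (W : complexBetti 𝒳 (2 * k)),
        (∀ s : ComplexPoints S,
          IsRationalClass (complexBetti.map (fiberι f s) (2 * k) W) ∧
            IsOfHodgeType (2 * k) (fiberOver f s) (2 * k) k k (complexBetti.map (fiberι f s) (2 * k) W)) →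
        ∀ (s₀ : ComplexPoints S) (e₀ : Y.X ≅ fiberOver f s₀),
          complexBetti.map e₀.hom (2 * k) (complexBetti.map (fiberι f s₀) (2 * k) W) = x →
          ∃ (U : Set (ComplexPoints S)) (H : complexBetti 𝒳 2) (q : ℚ), IsOpen U ∧ s₀ ∈ U ∧
            (∀ s : ComplexPoints S,
              IsRationalClass (complexBetti.map (fiberι f s) 2 H) ∧
                IsOfHodgeType (2 * k) (fiberOver f s) 2 1 1 (complexBetti.map (fiberι f s) 2 H)) ∧
            ∀ s ∈ U, ((q : ℚ) : ℂ) • cupPowTwo (complexBetti.map (fiberι f s) 2 H) k +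
              complexBetti.map (fiberι f s) (2 * k) W ∈ algebraicClasses (fiberOver f s) k

/-- **TLOCAL ⟸ SQGERM** (`k, p ≥ 1`): the class `x` at the tensor point is algebraic
(`mem_algebraicClasses_of_tensorPoint`), so the germ hypothesis applies.
[cite: Deligne1982HodgeCycles, §4 Remark 4.10 and proof of Thm. 4.8 (b)–(c)] -/
theorem hasLocallyAlgebraicTensorAnchors_of_germ {k p : ℕ} (hk : 0 < k) (hp : 0 < p)
    (hG : HasWeilSectionGermAtTensorPoints k p) : HasLocallyAlgebraicTensorAnchors k p := by
  intro Y Ψ hY hΨ hpt x hxW hxr 𝒳 S f hf h𝒳 hS hirr hsm hfib W hW s₀ e₀ he₀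
  have hxalg : x ∈ algebraicClasses Y.X k := mem_algebraicClasses_of_tensorPoint hk hp hY hpt hxW
  exact hG Y Ψ hY hΨ hpt x hxW hxr hxalg f hf h𝒳 hS hirr hsm hfib W hW s₀ e₀ he₀

/-- **SQGERM ⟸ TLOCAL** (drop the extra hypothesis). -/
theorem germ_of_hasLocallyAlgebraicTensorAnchors {k p : ℕ} (hT : HasLocallyAlgebraicTensorAnchors k p) :
    HasWeilSectionGermAtTensorPoints k p := by
  intro Y Ψ hY hΨ hpt x hxW hxr _ 𝒳 S f hf h𝒳 hS hirr hsm hfib W hW s₀ e₀ he₀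
  exact hT Y Ψ hY hΨ hpt x hxW hxr f hf h𝒳 hS hirr hsm hfib W hW s₀ e₀ he₀

/-- **EXACTNESS: TLOCAL(k,p) ⟺ SQGERM(k,p)** for `k, p ≥ 1` — door T's un-printed local input is literally a
variational-Hodge germ at the squares. [cite: Deligne1982HodgeCycles, §4 Remark 4.10] -/
theorem hasLocallyAlgebraicTensorAnchors_iff_germ {k p : ℕ} (hk : 0 < k) (hp : 0 < p) :
    HasLocallyAlgebraicTensorAnchors k p ↔ HasWeilSectionGermAtTensorPoints k p :=
  ⟨germ_of_hasLocallyAlgebraicTensorAnchors, hasLocallyAlgebraicTensorAnchors_of_germ hk hp⟩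

/-! ## 2. AVHCG: the variational Hodge conjecture, germ form, on abelian-fibred families -/

/-- **Variational Hodge conjecture — germ form — for degree-`2k` classes on abelian-fibred families**
(AVHCG(k)): for every smooth projective family `f : 𝒳 ⟶ S` of relative dimension `2k` with quasi-projective
`𝒳` over a smooth irreducible quasi-projective `S`, all of whose fibres are (isomorphic to) abelian varieties,
every global class `W ∈ H^{2k}(𝒳)` with rational `(k,k)` fibre restrictions, and every `s₀` with `W|_{s₀}`
ALGEBRAIC, the restrictions `W|_s` are algebraic for all `s` in an open neighbourhood of `s₀`. Grothendieck's
variational Hodge conjecture (germ form) restricted to abelian fibres; OPEN in general — known for classes of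
semiregular lci subschemes (Bloch), semiregular sheaves (Buchweitz–Flenner), semiregular perfect complexes
(restricted versions: Perry, Markman). Typed as a hypothesis; NOT asserted; on-path lemma below.
[cite: Grothendieck1966deRham, footnote 13] [cite: Bloch1972Semiregularity, Thm. 7.1]
[cite: BuchweitzFlenner2003, Thm. 5.1] [cite: Markman2025SecantWeil, §1.5, Lemma 11.3] [status: open] -/
@[conjecture] def AbelianSchemeVHCGerm (k : ℕ) : Prop :=
  ∀ ⦃𝒳 S : SchemeOver ℂ⦄ (f : 𝒳 ⟶ S), IsSmoothProjectiveFamily f (2 * k) →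
    IsQuasiProjectiveOver 𝒳 → IsQuasiProjectiveOver S → IrreducibleSpace S.left → Smooth S.hom →
    (∀ s : ComplexPoints S, ∃ A' : AbelianVariety ℂ, A'.dim = 2 * k ∧ Nonempty (A'.X ≅ fiberOver f s)) →
    ∀ (W : complexBetti 𝒳 (2 * k)),
      (∀ s : ComplexPoints S,
        IsRationalClass (complexBetti.map (fiberι f s) (2 * k) W) ∧
          IsOfHodgeType (2 * k) (fiberOver f s) (2 * k) k k (complexBetti.map (fiberι f s) (2 * k) W)) →
      ∀ s₀ : ComplexPoints S,
        complexBetti.map (fiberι f s₀) (2 * k) W ∈ algebraicClasses (fiberOver f s₀) k →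
        ∃ U : Set (ComplexPoints S), IsOpen U ∧ s₀ ∈ U ∧
          ∀ s ∈ U, complexBetti.map (fiberι f s) (2 * k) W ∈ algebraicClasses (fiberOver f s) k

/-- **AVHCG(k) ⟹ SQGERM(k,p)** for every `p`: transport the algebraicity of `x` to the fibre along the chart `e₀`
(`owf_isoTransport`), forget the `K`-structure of the fibres, take `H = 0`, `q = 0`.
[cite: Deligne1982HodgeCycles, proof of Thm. 4.8 (c)] [cite: CharlesSchnell2014Notes, Prop. 11.3.11 (proof)] -/
theorem germ_of_abelianSchemeVHCGerm {k p : ℕ} (hV : AbelianSchemeVHCGerm k) :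
    HasWeilSectionGermAtTensorPoints k p := by
  intro Y Ψ hY hΨ hpt x hxW hxr hxalg 𝒳 S f hf h𝒳 hS hirr hsm hfib W hW s₀ e₀ he₀
  -- the fibre class at `s₀` is algebraic: read `x` back on the fibre through the chart `e₀`
  have h₀ : complexBetti.map (fiberι f s₀) (2 * k) W ∈ algebraicClasses (fiberOver f s₀) k :=
    owf_isoTransport _ Y e₀ k _ (by rw [he₀]; exact hxalg)
  have hfib' : ∀ s : ComplexPoints S, ∃ A' : AbelianVariety ℂ, A'.dim = 2 * k ∧ Nonempty (A'.X ≅ fiberOver f s) :=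
    fun s => by
      obtain ⟨A', _, hA', _, hiso⟩ := hfib s
      exact ⟨A', hA', hiso⟩
  obtain ⟨U, hUo, hs₀U, hUalg⟩ := hV f hf h𝒳 hS hirr hsm hfib' W hW s₀ h₀
  refine ⟨U, 0, 0, hUo, hs₀U, fun s => ?_, fun s hs => ?_⟩
  · rw [map_zero]
    exact ⟨IsRationalClass.zero,
      isOfHodgeType_zero_of_isSmoothProjective nonempty_hodgeModel_holds (hf.isSmoothProjective s) _ _ _⟩
  · rw [Rat.cast_zero, zero_smul, zero_add]
    exact hUalg s hs

/-- **ON-PATH: `HodgeConjecture` ⟹ AVHCG(k)** (every rational `(k,k)`-class on every smooth projective fibre is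
algebraic; `U = S(ℂ)`). [folklore] -/
theorem abelianSchemeVHCGerm_of_hodgeConjecture (hHC : _root_.HodgeConjecture) (k : ℕ) :
    AbelianSchemeVHCGerm k := by
  intro 𝒳 S f hf _ _ _ _ _ W hW s₀ _
  exact ⟨Set.univ, isOpen_univ, Set.mem_univ _,
    fun s _ => (hHC (hf.isSmoothProjective s)).2 k _ (hW s).1 (hW s).2⟩

/-- ON-PATH: `HodgeConjecture` ⟹ SQGERM(k,p). [folklore] -/
theorem germ_of_hodgeConjecture (hHC : _root_.HodgeConjecture) (k p : ℕ) :
    HasWeilSectionGermAtTensorPoints k p :=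
  germ_of_abelianSchemeVHCGerm (abelianSchemeVHCGerm_of_hodgeConjecture hHC k)

/-! ## 3. The rungs BY NAME from Deligne's all-`d` family fact and the germs -/

/-- **R∞ (`WeilClassesImaginaryQuadratic`) ⟸ Deligne-all ∧ the Weil-section germs at tensor points
(`n ≥ 2`, `d ≥ 1`)** — hypotheses BY NAME, nothing asserted.
[cite: Deligne1982HodgeCycles, proof of Thm. 4.8 (a)–(c)] [cite: Markman2025SecantWeil, §1.5] -/
theorem weilClassesImaginaryQuadratic_of_deligneAll_of_germs
    (hD : deligne1982_weilFamily_hodgeWeilSection_all)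
    (hG : ∀ n : ℕ, 2 ≤ n → ∀ d : ℕ, 0 < d → HasWeilSectionGermAtTensorPoints n d) :
    WeilClassesImaginaryQuadratic :=
  weilClassesImaginaryQuadratic_of_deligneAll_of_tensorLocalAnchors hD
    fun n hn d hd => hasLocallyAlgebraicTensorAnchors_of_germ (by omega) hd (hG n hn d hd)

/-- **R∞ ⟸ Deligne-all ∧ ∀ n ≥ 2, AVHCG(n)**: the whole imaginary-quadratic Weil ladder above the floor follows
from ONE refereed-source named fact and the variational Hodge conjecture in germ form on abelian-fibred families.
[cite: Deligne1982HodgeCycles, proof of Thm. 4.8] [cite: Andre1996Motifs, Thm. 0.5 and Thm. 0.6.2 (motivated analogue)] -/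
theorem weilClassesImaginaryQuadratic_of_deligneAll_of_abelianSchemeVHCGerm
    (hD : deligne1982_weilFamily_hodgeWeilSection_all) (hV : ∀ n : ℕ, 2 ≤ n → AbelianSchemeVHCGerm n) :
    WeilClassesImaginaryQuadratic :=
  weilClassesImaginaryQuadratic_of_deligneAll_of_germs hD fun n hn _ _ => germ_of_abelianSchemeVHCGerm (hV n hn)

/-- **stmt-HodgeConjecture-2524 (`Theses.SevenfoldWeilCensus.WeilSixfolds`: ALL `√-d`-Weil abelian sixfolds,
every `d`, split AND non-split) ⟸ Deligne-all ∧ the germs SQGERM(3,d), `d ≥ 1`** — BY NAME.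
[cite: Deligne1982HodgeCycles, proof of Thm. 4.8 (a)–(c)] [cite: Markman2025SecantWeil, §1.5] -/
theorem weilSixfolds_of_deligneAll_of_germs (hD : deligne1982_weilFamily_hodgeWeilSection_all)
    (hG : ∀ d : ℕ, 0 < d → HasWeilSectionGermAtTensorPoints 3 d) :
    Theses.SevenfoldWeilCensus.WeilSixfolds :=
  weilSixfolds_of_deligneAll_of_tensorLocalAnchors hD
    fun d hd => hasLocallyAlgebraicTensorAnchors_of_germ (by norm_num) hd (hG d hd)

/-- **stmt-HodgeConjecture-2524 ⟸ Deligne-all ∧ AVHCG(3)**: all Weil abelian SIXFOLDS from the variational Hodge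
conjecture (germ form) for degree-6 classes on abelian-fibred families of relative dimension 6.
[cite: Deligne1982HodgeCycles, proof of Thm. 4.8] [cite: Grothendieck1966deRham, footnote 13] -/
theorem weilSixfolds_of_deligneAll_of_abelianSchemeVHCGerm (hD : deligne1982_weilFamily_hodgeWeilSection_all)
    (hV : AbelianSchemeVHCGerm 3) : Theses.SevenfoldWeilCensus.WeilSixfolds :=
  weilSixfolds_of_deligneAll_of_germs hD fun _ _ => germ_of_abelianSchemeVHCGerm hV

/-- **R1′ (`NonsplitSixfolds`) ⟸ Deligne-all ∧ AVHCG(3)** — the lowest open rung, BY NAME.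
[cite: Deligne1982HodgeCycles, proof of Thm. 4.8] -/
theorem nonsplitSixfolds_of_deligneAll_of_abelianSchemeVHCGerm (hD : deligne1982_weilFamily_hodgeWeilSection_all)
    (hV : AbelianSchemeVHCGerm 3) : NonsplitSixfolds :=
  nonsplitSixfolds_of_deligneAll_of_tensorLocalAnchors hD
    fun d hd => hasLocallyAlgebraicTensorAnchors_of_germ (by norm_num) hd (germ_of_abelianSchemeVHCGerm hV)

/-- **R1′ ⟸ Deligne-all ∧ the germs SQGERM(3,d)** — BY NAME. [cite: Deligne1982HodgeCycles, proof of Thm. 4.8] -/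
theorem nonsplitSixfolds_of_deligneAll_of_germs (hD : deligne1982_weilFamily_hodgeWeilSection_all)
    (hG : ∀ d : ℕ, 0 < d → HasWeilSectionGermAtTensorPoints 3 d) : NonsplitSixfolds :=
  nonsplitSixfolds_of_deligneAll_of_tensorLocalAnchors hD
    fun d hd => hasLocallyAlgebraicTensorAnchors_of_germ (by norm_num) hd (hG d hd)

end Summit.HodgeConjecture.HodgeConjecture.WeilTypeLadder

end
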